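/-
Copyright (c) 2026 the pub-hodgecm-mathlib formalisation cell (harness21).  Prover seat hodgecm-mathlib-K2E4-p08 (g2), Track B «K2-LIT» ∕ h413, ‹S› ROAD J brick J1′, rung 5:
the compact-side package at `C′ := Z(ε′)` WITH VALUES (the second class `ε′` exposed, the descent value at the centre, the named `Δ‴` constant).  2026-09-04.
-/
import Literature.NumberTheory.Rogawski1990.LocalTransferCentralSingularCompactPackageCM   -- ★ p842393 A-p14 (g28): the package; this file is its twin with values
import Literature.NumberTheory.Rogawski1990.LocalTransferSecondClassDescentValueCM        -- ★ rung 2 (this seat) p855815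
import Literature.NumberTheory.Rogawski1990.FinExplicitTransferFactorBadFrameValue          -- ★ rung 4 (this seat) p855857
import HarnessLib

/-!
# The compact-side package of the (S1) germ at `ε_H = (a·1₂, u)` WITH VALUES — road J brick J1′, rung 5

Twin of ★ `exists_compactSidePackage_of_badFrame` (p842393; [Rogawski1990, Prop. 8.1.3, Prop. 8.2.1 (a)(d)]; [LanglandsShelstad1990Descent, §2.4]; [Kottwitz1988, §2]) —
same ∀-prefix (the stub `stub_N6nsS1pkg`'s), same concrete witnesses (`C′ := Z(ε′)`, Haar `ν′`, `P″ :=` regular, canonical `m′`, `ε_C := ε′`), and an output enlarged by: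
the framed SECOND CLASS `ε′ ∈ G′_v` itself with its frame relation `ε′·P′ = P′·(a·1₂ ⊕ᶠ u)` and its matching with `ε_H`; the centrality of `ε_C` in `C′`; `ν′(C′) ≠ 0`; the
descent binder WITH VALUE `ψ_ε(ε_C) = ν′(C′)⁻¹ · ∫_{G′_v} ψ(y ε′ y⁻¹) dν_G` (★ `exists_isLocallyConstant_descent_secondClass_and_apply_centre`); and (Δ-θ′) with its constant NAMED
`Δ‴_v(ε_H, ε′)` (★ `exists_nhds_finExplicitCollection_Δ_eq_secondClass_of_frame`).  These are exactly the inputs of the compact-side junction with value ★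
`exists_nhds_finsum_side_eq_stableOrbitalIntegralRel_and_apply_centre_of_compact_dock` (rung 3).

* **`exists_compactSidePackage_of_badFrame_withValues`**.

HONEST LABEL: a Literature-side helper toward h413 (`stmt-HodgeConjecture-24833`); HC_CM is proved only modulo its printed citations until rung 0 closes; assembly only.
-/

set_option autoImplicit false

noncomputable section

open NumberField IsDedekindDomain MeasureTheory Measure Topology Filter Matrix
open Literature.NumberTheory.Automorphic Literature.NumberTheory.GaloisRepresentations
open Literature.AlgebraicGeometry.ShimuraVarieties (unitaryGroup hermForm)
open scoped MatrixGroups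

namespace Literature.NumberTheory.Rogawski1990

/-! ## §1 Plumbing -/

section Generic

variable {S : Type*} [CommRing S] {N₁ N₂ : ℕ}

/-- `ᵗ(σ(s•1)) · G · (s•1) = (σ s · s) • G`; in particular a norm-one scalar block is unitary for every Gram block. [folklore] -/
private theorem twistGram_smul_one₁₁ (σ : S →+* S) {n : ℕ} (G : Matrix (Fin n) (Fin n) S) {s : S} (hs : σ s * s = 1) :
    twistGram σ G (s • (1 : Matrix (Fin n) (Fin n) S)) = G := by
  rw [twistGram_def, Matrix.smul_one_eq_diagonal, Matrix.diagonal_map (map_zero σ), Matrix.diagonal_transpose, ← Matrix.smul_one_eq_diagonal,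
    ← Matrix.smul_one_eq_diagonal, Matrix.smul_mul, Matrix.one_mul, Matrix.mul_smul, Matrix.mul_one, smul_smul, mul_comm, hs, one_smul]

/-- The coordinate swap `2 ↔ 3` is an involution. [folklore] -/
private theorem swap_mul_swap₁₁ : !![(1 : S), 0, 0; 0, 0, 1; 0, 1, 0] * !![(1 : S), 0, 0; 0, 0, 1; 0, 1, 0] = 1 := by
  ext i j
  fin_cases i <;> fin_cases j <;> simp [Matrix.mul_apply, Fin.sum_univ_three]

/-- A `1 × 1` matrix is the scalar `C₀₀`. [folklore] -/
private theorem fin_one_eq_smul_one₁₁ (C : Matrix (Fin 1) (Fin 1) S) : C = C 0 0 • (1 : Matrix (Fin 1) (Fin 1) S) := by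
  ext i j
  fin_cases i; fin_cases j
  simp

end Generic

section CM

variable (L : Type) [Field L] [NumberField L] [IsCMField L]

/-- An anisotropic hermitian matrix is invertible (local copy of ★ `det_ne_zero_of_anisotropic`). [cite: Rogawski1990, §3.8 Prop. 3.8.1 (a) p. 27] -/
private theorem det_ne_zero_of_anisotropic₁₁ {H : Matrix (Fin 3) (Fin 3) L}
    (hH0 : ∀ x : Fin 3 → L, hermForm (cmConjRingHom L) H x x = 0 → x = 0) : H.det ≠ 0 := by
  intro hdet
  obtain ⟨x, hx, hHx⟩ := Matrix.exists_mulVec_eq_zero_iff.mpr hdet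
  refine hx (hH0 x ?_)
  rw [Literature.AlgebraicGeometry.ShimuraVarieties.hermForm, hHx, dotProduct_zero]

/-- At a place with ONE prime of `L` above it, that prime is fixed by complex conjugation (local copy of ★ `smul_eq_of_subsingleton_placesOver`).
[cite: CasselsFrohlichANT1967, Ch. VII Prop. 1.2 (ii)] -/
private theorem smul_eq_of_subsingleton_placesOver₁₁ {v : HeightOneSpectrum (𝓞 ↥(maximalRealSubfield L))}
    (hv : Subsingleton (UnitaryGroup.PlacesOver L v)) (w : UnitaryGroup.PlacesOver L v) : IsCMField.complexConj L • w.1 = w.1 := by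
  have hmem : (IsCMField.complexConj L • w.1).under (𝓞 ↥(maximalRealSubfield L)) = v := by
    rw [HeightOneSpectrum.under_algEquiv_smul]; exact w.2
  exact congrArg Subtype.val (Subsingleton.elim (⟨IsCMField.complexConj L • w.1, hmem⟩ : UnitaryGroup.PlacesOver L v) w)

end CM

/-! ## §2 The head -/

set_option maxHeartbeats 400000 in  -- HB: ★ p842393's assembly (already near the default budget) + the matching `ε′ = (P′W)·ι(ε_H)·(P′W)⁻¹` and three value clauses
open scoped Classical in
/-- **THE COMPACT-SIDE PACKAGE WITH VALUES** — ★ `exists_compactSidePackage_of_badFrame` (p842393) at the concrete compact dock `C′ := Z(ε′)`, exposing in addition the framed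
second class `ε′` (`ε′·P′ = P′·(a·1₂ ⊕ᶠ u)`, matched with `ε_H`), the centrality of `ε_C = ε′` in `C′`, `ν′(C′) ≠ 0`, the VALUE of the descended function at the centre
(`ψ_ε(ε′) = ν′(C′)⁻¹·∫_{G′_v} ψ(y ε′ y⁻¹) dν_G`, ★ rung 2) and the NAMED constant of (Δ-θ′) (`Δ‴_v(ε_H, ε′)`, ★ rung 4).
[cite: Rogawski1990, §8.1 Prop. 8.1.3 pp. 110–111; §8.2 Prop. 8.2.1 (a)(d) p. 112] [cite: LanglandsShelstad1990Descent, §2.4] [cite: Kottwitz1988, §2] -/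
theorem exists_compactSidePackage_of_badFrame_withValues :
    ∀ (L : Type) [Field L] [NumberField L] [IsCMField L] (H' : Matrix (Fin 3) (Fin 3) L) (μ : HeckeCharacter L)
      [∀ v : HeightOneSpectrum (𝓞 ↥(maximalRealSubfield L)),
        MeasurableSpace ((UnitaryGroup.cmDatum L 2 (Matrix.of fun i j : Fin 2 => if i.val + j.val + 1 = 2 then (1 : L) else 0)).Local v ×
          (UnitaryGroup.cmDatum L 1 (Matrix.of fun i j : Fin 1 => if i.val + j.val + 1 = 1 then (1 : L) else 0)).Local v)]
      [∀ v : HeightOneSpectrum (𝓞 ↥(maximalRealSubfield L)),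
        BorelSpace ((UnitaryGroup.cmDatum L 2 (Matrix.of fun i j : Fin 2 => if i.val + j.val + 1 = 2 then (1 : L) else 0)).Local v ×
          (UnitaryGroup.cmDatum L 1 (Matrix.of fun i j : Fin 1 => if i.val + j.val + 1 = 1 then (1 : L) else 0)).Local v)]
      [∀ v : HeightOneSpectrum (𝓞 ↥(maximalRealSubfield L)), MeasurableSpace ((UnitaryGroup.cmDatum L 3 H').Local v)]
      [∀ v : HeightOneSpectrum (𝓞 ↥(maximalRealSubfield L)), BorelSpace ((UnitaryGroup.cmDatum L 3 H').Local v)]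
      (νH : ∀ v : HeightOneSpectrum (𝓞 ↥(maximalRealSubfield L)),
        Measure ((UnitaryGroup.cmDatum L 2 (Matrix.of fun i j : Fin 2 => if i.val + j.val + 1 = 2 then (1 : L) else 0)).Local v ×
          (UnitaryGroup.cmDatum L 1 (Matrix.of fun i j : Fin 1 => if i.val + j.val + 1 = 1 then (1 : L) else 0)).Local v))
      (νG : ∀ v : HeightOneSpectrum (𝓞 ↥(maximalRealSubfield L)), Measure ((UnitaryGroup.cmDatum L 3 H').Local v))
      [∀ v, (νH v).IsHaarMeasure] [∀ v, (νH v).IsMulRightInvariant] [∀ v, (νG v).IsHaarMeasure] [∀ v, (νG v).IsMulRightInvariant],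
      μ.IsUnitary →
      (∀ x : ideleGroup ↥(maximalRealSubfield L), μ (AdeleRing.ideleBaseChange (↥(maximalRealSubfield L)) L x) = quadraticHeckeCharCM L x) →
      (H'.map (cmConjRingHom L)).transpose = H' →
      (∀ x : Fin 3 → L, hermForm (cmConjRingHom L) H' x x = 0 → x = 0) →
      ∀ (v : HeightOneSpectrum (𝓞 ↥(maximalRealSubfield L))), Subsingleton (UnitaryGroup.PlacesOver L v) →
      ∀ [_iH : ∀ a : ((UnitaryGroup.cmDatum L 2 (Matrix.of fun i j : Fin 2 => if i.val + j.val + 1 = 2 then (1 : L) else 0)).Local v × (UnitaryGroup.cmDatum L 1 (Matrix.of fun i j : Fin 1 => if i.val + j.val + 1 = 1 then (1 : L) else 0)).Local v),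
          MeasurableSpace (((UnitaryGroup.cmDatum L 2 (Matrix.of fun i j : Fin 2 => if i.val + j.val + 1 = 2 then (1 : L) else 0)).Local v × (UnitaryGroup.cmDatum L 1 (Matrix.of fun i j : Fin 1 => if i.val + j.val + 1 = 1 then (1 : L) else 0)).Local v) ⧸
            Subgroup.centralizer ({a} : Set ((UnitaryGroup.cmDatum L 2 (Matrix.of fun i j : Fin 2 => if i.val + j.val + 1 = 2 then (1 : L) else 0)).Local v × (UnitaryGroup.cmDatum L 1 (Matrix.of fun i j : Fin 1 => if i.val + j.val + 1 = 1 then (1 : L) else 0)).Local v)))]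
        [_bH : ∀ a : ((UnitaryGroup.cmDatum L 2 (Matrix.of fun i j : Fin 2 => if i.val + j.val + 1 = 2 then (1 : L) else 0)).Local v × (UnitaryGroup.cmDatum L 1 (Matrix.of fun i j : Fin 1 => if i.val + j.val + 1 = 1 then (1 : L) else 0)).Local v),
          BorelSpace (((UnitaryGroup.cmDatum L 2 (Matrix.of fun i j : Fin 2 => if i.val + j.val + 1 = 2 then (1 : L) else 0)).Local v × (UnitaryGroup.cmDatum L 1 (Matrix.of fun i j : Fin 1 => if i.val + j.val + 1 = 1 then (1 : L) else 0)).Local v) ⧸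
            Subgroup.centralizer ({a} : Set ((UnitaryGroup.cmDatum L 2 (Matrix.of fun i j : Fin 2 => if i.val + j.val + 1 = 2 then (1 : L) else 0)).Local v × (UnitaryGroup.cmDatum L 1 (Matrix.of fun i j : Fin 1 => if i.val + j.val + 1 = 1 then (1 : L) else 0)).Local v)))]
        [_iG : ∀ γ : ((UnitaryGroup.cmDatum L 3 H').Local v), MeasurableSpace (((UnitaryGroup.cmDatum L 3 H').Local v) ⧸ Subgroup.centralizer ({γ} : Set ((UnitaryGroup.cmDatum L 3 H').Local v)))]
        [_bG : ∀ γ : ((UnitaryGroup.cmDatum L 3 H').Local v), BorelSpace (((UnitaryGroup.cmDatum L 3 H').Local v) ⧸ Subgroup.centralizer ({γ} : Set ((UnitaryGroup.cmDatum L 3 H').Local v)))]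
        (mH : OrbitalMeasureFamily ((UnitaryGroup.cmDatum L 2 (Matrix.of fun i j : Fin 2 => if i.val + j.val + 1 = 2 then (1 : L) else 0)).Local v × (UnitaryGroup.cmDatum L 1 (Matrix.of fun i j : Fin 1 => if i.val + j.val + 1 = 1 then (1 : L) else 0)).Local v))
        (mG : OrbitalMeasureFamily ((UnitaryGroup.cmDatum L 3 H').Local v)),
      mH.IsCanonical (IsLocalGRegular L v) (νH v) → mG.IsCanonical (fun γ => IsRegularElt (γ.val : GL (Fin 3) (UnitaryGroup.LocalRing L v))) (νG v) →
      ∀ (φ : ((UnitaryGroup.cmDatum L 3 H').Local v) → ℂ), IsLocSmooth φ →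
      ∀ (εH : ((UnitaryGroup.cmDatum L 2 (Matrix.of fun i j : Fin 2 => if i.val + j.val + 1 = 2 then (1 : L) else 0)).Local v × (UnitaryGroup.cmDatum L 1 (Matrix.of fun i j : Fin 1 => if i.val + j.val + 1 = 1 then (1 : L) else 0)).Local v)) (a : (UnitaryGroup.LocalRing L v)),
        (εH.1.val.val : Matrix (Fin 2) (Fin 2) (UnitaryGroup.LocalRing L v)) = a • (1 : Matrix (Fin 2) (Fin 2) (UnitaryGroup.LocalRing L v)) →
        (εH.2.val.val : Matrix (Fin 1) (Fin 1) (UnitaryGroup.LocalRing L v)) 0 0 ≠ a →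
        -- the central dock (★ `exists_centralDock_of_fst_eq_smul_one`)
        ∀ (ε : ((UnitaryGroup.cmDatum L 3 H').Local v)) (y : GL (Fin 3) (UnitaryGroup.LocalRing L v)) (θ : ((UnitaryGroup.cmDatum L 2 (Matrix.of fun i j : Fin 2 => if i.val + j.val + 1 = 2 then (1 : L) else 0)).Local v × (UnitaryGroup.cmDatum L 1 (Matrix.of fun i j : Fin 1 => if i.val + j.val + 1 = 1 then (1 : L) else 0)).Local v) ≃ₜ* ↥(Subgroup.centralizer ({ε} : Set ((UnitaryGroup.cmDatum L 3 H').Local v)))),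
        (θ εH).1 = ε →
        (∀ z : ((UnitaryGroup.cmDatum L 2 (Matrix.of fun i j : Fin 2 => if i.val + j.val + 1 = 2 then (1 : L) else 0)).Local v × (UnitaryGroup.cmDatum L 1 (Matrix.of fun i j : Fin 1 => if i.val + j.val + 1 = 1 then (1 : L) else 0)).Local v), (((θ z).1).val : GL (Fin 3) (UnitaryGroup.LocalRing L v)) = y * ((endoEmbLocal L v z).val : GL (Fin 3) (UnitaryGroup.LocalRing L v)) * y⁻¹) →
        -- the bad frame on the dock (★ `exists_badFrame_dock`)
        ∀ (W : GL (Fin 3) (UnitaryGroup.LocalRing L v)), W.val = !![(1 : UnitaryGroup.LocalRing L v), 0, 0; 0, 0, 1; 0, 1, 0] →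
        ∀ (G₁ G₁' : Matrix (Fin 2) (Fin 2) (UnitaryGroup.LocalRing L v)) (G₂ G₂' : Matrix (Fin 1) (Fin 1) (UnitaryGroup.LocalRing L v)) (P' : GL (Fin (2 + 1)) (UnitaryGroup.LocalRing L v)),
        twistGram (UnitaryGroup.conjLocal L (IsCMField.complexConj L) v) ((UnitaryGroup.adelicForm L 3 H').map (UnitaryGroup.adeleToLocal L v)) (y * W).val = UnitaryGroup.finSum 2 1 G₁ G₂ →
        twistGram (UnitaryGroup.conjLocal L (IsCMField.complexConj L) v) ((UnitaryGroup.adelicForm L 3 H').map (UnitaryGroup.adeleToLocal L v)) P'.val = UnitaryGroup.finSum 2 1 G₁' G₂' →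
        (¬ ∃ z : UnitaryGroup.LocalRing L v, IsUnit z ∧ G₁'.det = G₁.det * (UnitaryGroup.conjLocal L (IsCMField.complexConj L) v z * z)) →
        -- the compact-side package: an abstract compact dock `C′` carrying (D2ε′)+(sat′), (Δ-θ′), (CNT)
        ∃ (C' : Type) (_ : Group C') (_ : TopologicalSpace C') (_ : IsTopologicalGroup C') (_ : CompactSpace C') (_ : LocallyCompactSpace C')
          (_ : SecondCountableTopology C') (_ : T2Space C') (_ : MeasurableSpace C') (_ : BorelSpace C')
          (_ : ∀ m : C', MeasurableSpace (C' ⧸ Subgroup.centralizer ({m} : Set C'))) (_ : ∀ m : C', BorelSpace (C' ⧸ Subgroup.centralizer ({m} : Set C')))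
          (ν' : Measure C') (_ : ν'.IsHaarMeasure) (_ : ν'.IsMulRightInvariant) (P'' : C' → Prop) (m' : OrbitalMeasureFamily C') (_ : m'.IsCanonical P'' ν') (εC : C')
          (ε' : ((UnitaryGroup.cmDatum L 3 H').Local v)),
        (ε'.val.val : Matrix (Fin 3) (Fin 3) (UnitaryGroup.LocalRing L v)) * P'.val =
          P'.val * UnitaryGroup.finSum 2 1 (a • (1 : Matrix (Fin 2) (Fin 2) (UnitaryGroup.LocalRing L v))) (εH.2.val.val : Matrix (Fin 1) (Fin 1) (UnitaryGroup.LocalRing L v)) ∧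
        IsLocalNormPair L H' v εH ε' ∧
        (∀ k : C', k * εC * k⁻¹ = εC) ∧
        (((ν'.real Set.univ : ℝ)) : ℂ) ≠ 0 ∧
        (∀ ψ : ((UnitaryGroup.cmDatum L 3 H').Local v) → ℂ, IsLocSmooth ψ → ∃ ψε : C' → ℂ, IsLocallyConstant ψε ∧
          ψε εC = (((ν'.real Set.univ)⁻¹ : ℝ) : ℂ) * ∫ y, ψ (y * ε' * y⁻¹) ∂(νG v) ∧ ∀ B' ∈ 𝓝 εC, ∃ V ∈ 𝓝 εH, ∀ γH ∈ V, IsLocalGRegular L v γH →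
        ∀ c : ConjClasses ((UnitaryGroup.cmDatum L 3 H').Local v), (∃ x : ((UnitaryGroup.cmDatum L 3 H').Local v), (∃ B : Matrix (Fin 2) (Fin 2) (UnitaryGroup.LocalRing L v), ((x * Quotient.out c * x⁻¹).val.val : Matrix (Fin 3) (Fin 3) (UnitaryGroup.LocalRing L v)) * P'.val = P'.val * UnitaryGroup.finSum 2 1 B (γH.2.val.val : Matrix (Fin 1) (Fin 1) (UnitaryGroup.LocalRing L v)))) → IsLocalNormPair L H' v γH (Quotient.out c) →
          ∃ m ∈ B', P'' (Quotient.out (ConjClasses.mk m)) ∧ classOrbitalIntegral mG ψ c = classOrbitalIntegral m' ψε (ConjClasses.mk m)) ∧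
        (∃ VΔ ∈ 𝓝 εH, ∀ γH ∈ VΔ, IsLocalGRegular L v γH → ∀ c : ConjClasses ((UnitaryGroup.cmDatum L 3 H').Local v), (∃ x : ((UnitaryGroup.cmDatum L 3 H').Local v), (∃ B : Matrix (Fin 2) (Fin 2) (UnitaryGroup.LocalRing L v), ((x * Quotient.out c * x⁻¹).val.val : Matrix (Fin 3) (Fin 3) (UnitaryGroup.LocalRing L v)) * P'.val = P'.val * UnitaryGroup.finSum 2 1 B (γH.2.val.val : Matrix (Fin 1) (Fin 1) (UnitaryGroup.LocalRing L v)))) →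
        IsLocalNormPair L H' v γH (Quotient.out c) → ((finExplicitCollection L H' μ (finExplicitDelta_conj_left_all L H' μ) (finExplicitDelta_conj_right_all L H' μ)) v).Δ γH (Quotient.out c) = finExplicitDelta L v H' εH μ ε') ∧
        (∃ Vc ∈ 𝓝 εH, ∀ γH ∈ Vc, IsLocalGRegular L v γH →
        {c : ConjClasses ((UnitaryGroup.cmDatum L 3 H').Local v) | (∃ x : ((UnitaryGroup.cmDatum L 3 H').Local v), (∃ B : Matrix (Fin 2) (Fin 2) (UnitaryGroup.LocalRing L v), ((x * Quotient.out c * x⁻¹).val.val : Matrix (Fin 3) (Fin 3) (UnitaryGroup.LocalRing L v)) * P'.val = P'.val * UnitaryGroup.finSum 2 1 B (γH.2.val.val : Matrix (Fin 1) (Fin 1) (UnitaryGroup.LocalRing L v)))) ∧ IsLocalNormPair L H' v γH (Quotient.out c)}.Finite ∧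
        {d : ConjClasses (((UnitaryGroup.cmDatum L 2 (Matrix.of fun i j : Fin 2 => if i.val + j.val + 1 = 2 then (1 : L) else 0)).Local v) ×
      ((UnitaryGroup.cmDatum L 1 (Matrix.of fun i j : Fin 1 => if i.val + j.val + 1 = 1 then (1 : L) else 0)).Local v)) | IsLocalStablyConjH L v γH (Quotient.out d)}.Finite ∧
        (CompactSpace (Subgroup.centralizer ({γH.1} : Set ((UnitaryGroup.cmDatum L 2 (Matrix.of fun i j : Fin 2 => if i.val + j.val + 1 = 2 then (1 : L) else 0)).Local v))) →
          {c : ConjClasses ((UnitaryGroup.cmDatum L 3 H').Local v) | (∃ x : ((UnitaryGroup.cmDatum L 3 H').Local v), (∃ B : Matrix (Fin 2) (Fin 2) (UnitaryGroup.LocalRing L v), ((x * Quotient.out c * x⁻¹).val.val : Matrix (Fin 3) (Fin 3) (UnitaryGroup.LocalRing L v)) * P'.val = P'.val * UnitaryGroup.finSum 2 1 B (γH.2.val.val : Matrix (Fin 1) (Fin 1) (UnitaryGroup.LocalRing L v)))) ∧ IsLocalNormPair L H' v γH (Quotient.out c)}.ncard =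
            {d : ConjClasses (((UnitaryGroup.cmDatum L 2 (Matrix.of fun i j : Fin 2 => if i.val + j.val + 1 = 2 then (1 : L) else 0)).Local v) ×
      ((UnitaryGroup.cmDatum L 1 (Matrix.of fun i j : Fin 1 => if i.val + j.val + 1 = 1 then (1 : L) else 0)).Local v)) | IsLocalStablyConjH L v γH (Quotient.out d)}.ncard) ∧
        (¬ CompactSpace (Subgroup.centralizer ({γH.1} : Set ((UnitaryGroup.cmDatum L 2 (Matrix.of fun i j : Fin 2 => if i.val + j.val + 1 = 2 then (1 : L) else 0)).Local v))) →
          ∀ c : ConjClasses ((UnitaryGroup.cmDatum L 3 H').Local v), (∃ x : ((UnitaryGroup.cmDatum L 3 H').Local v), (∃ B : Matrix (Fin 2) (Fin 2) (UnitaryGroup.LocalRing L v), ((x * Quotient.out c * x⁻¹).val.val : Matrix (Fin 3) (Fin 3) (UnitaryGroup.LocalRing L v)) * P'.val = P'.val * UnitaryGroup.finSum 2 1 B (γH.2.val.val : Matrix (Fin 1) (Fin 1) (UnitaryGroup.LocalRing L v)))) → ¬ IsLocalNormPair L H' v γH (Quotient.out c))) := by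
  intro L _ _ _ H' μ _ _ _ _ νH νG _ _ _ _ hμu hμω hherm hanis v hv _iH _bH _iG _bG mH mG hmH hmG φ hφ εH a ha hu ε y θ hθε hθ W hW G₁ G₁' G₂ G₂' P'
    hPW hP' hnn
  classical
  obtain ⟨w⟩ := (inferInstance : Nonempty (UnitaryGroup.PlacesOver L v))
  have hw : IsCMField.complexConj L • w.1 = w.1 := smul_eq_of_subsingleton_placesOver₁₁ L hv w
  have hdet' : H'.det ≠ 0 := det_ne_zero_of_anisotropic₁₁ L hanis
  have hHd : IsUnit ((UnitaryGroup.adelicForm L 3 H').map (UnitaryGroup.adeleToLocal L v)).det := UnitaryGroup.isUnit_det_localForm L 3 H' v hdet'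
  have ha1 : (UnitaryGroup.conjLocal L (IsCMField.complexConj L) v) a * a = 1 := conjLocal_mul_self_of_fst_eq_smul_one L v εH ha
  have hu1 : (UnitaryGroup.conjLocal L (IsCMField.complexConj L) v) (finGammaTwo L v εH) * finGammaTwo L v εH = 1 := conjLocal_finGammaTwo_mul_finGammaTwo L v εH
  have h2u : (εH.2.val.val : Matrix (Fin 1) (Fin 1) (UnitaryGroup.LocalRing L v)) = finGammaTwo L v εH • (1 : Matrix (Fin 1) (Fin 1) (UnitaryGroup.LocalRing L v)) :=
    fin_one_eq_smul_one₁₁ _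
  have hau : IsUnit (a - finGammaTwo L v εH) := isUnit_localRing_of_ne_zero_of_subsingleton L v hv (sub_ne_zero.2 (Ne.symm hu))
  -- (1) the framed second class `ε′ := P′ · T · P′⁻¹` with `T := W ι_v(ε_H) W`, `T = a•1₂ ⊕ᶠ u`
  obtain ⟨T, hT⟩ : ∃ T : GL (Fin (2 + 1)) (UnitaryGroup.LocalRing L v), T = W * ((endoEmbLocal L v εH).val : GL (Fin 3) (UnitaryGroup.LocalRing L v)) * W := ⟨_, rfl⟩
  have hTval : T.val = (UnitaryGroup.finSum 2 1 (a • (1 : Matrix (Fin 2) (Fin 2) (UnitaryGroup.LocalRing L v))) (εH.2.val.val : Matrix (Fin 1) (Fin 1) (UnitaryGroup.LocalRing L v))) := by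
    rw [hT, Units.val_mul, Units.val_mul, hW, coe_endoEmbLocal_eq_swap_mul_finSum_mul_swap, ha]
    rw [← Matrix.mul_assoc, ← Matrix.mul_assoc, swap_mul_swap₁₁, Matrix.one_mul, Matrix.mul_assoc, swap_mul_swap₁₁, Matrix.mul_one]
  have hB1 : twistGram (UnitaryGroup.conjLocal L (IsCMField.complexConj L) v) G₁' (a • (1 : Matrix (Fin 2) (Fin 2) (UnitaryGroup.LocalRing L v))) = G₁' := twistGram_smul_one₁₁ _ G₁' ha1
  have hC1 : twistGram (UnitaryGroup.conjLocal L (IsCMField.complexConj L) v) G₂' (εH.2.val.val : Matrix (Fin 1) (Fin 1) (UnitaryGroup.LocalRing L v)) = G₂' := by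
    rw [h2u]; exact twistGram_smul_one₁₁ _ G₂' hu1
  have hmem : P' * T * P'⁻¹ ∈ unitaryGroup (UnitaryGroup.conjLocal L (IsCMField.complexConj L) v) ((UnitaryGroup.adelicForm L 3 H').map (UnitaryGroup.adeleToLocal L v)) := frame_conj_mem_unitaryGroup (UnitaryGroup.conjLocal L (IsCMField.complexConj L) v) (N₁ := 2) (N₂ := 1) _ hP' hTval hB1 hC1
  obtain ⟨ε', hε'val⟩ : ∃ ε' : ((UnitaryGroup.cmDatum L 3 H').Local v), (ε'.val : GL (Fin 3) (UnitaryGroup.LocalRing L v)) = P' * T * P'⁻¹ := ⟨⟨P' * T * P'⁻¹, hmem⟩, rfl⟩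
  have hε'P : (ε'.val.val : Matrix (Fin 3) (Fin 3) (UnitaryGroup.LocalRing L v)) * P'.val = P'.val * (UnitaryGroup.finSum 2 1 (a • (1 : Matrix (Fin 2) (Fin 2) (UnitaryGroup.LocalRing L v))) (εH.2.val.val : Matrix (Fin 1) (Fin 1) (UnitaryGroup.LocalRing L v))) := by
    rw [← hTval, hε'val, ← Units.val_mul, ← Units.val_mul, inv_mul_cancel_right]
  have hε'D : (ε'.val.val : Matrix (Fin 3) (Fin 3) (UnitaryGroup.LocalRing L v)) * P'.val = P'.val * (UnitaryGroup.finSum 2 1 (a • (1 : Matrix (Fin 2) (Fin 2) (UnitaryGroup.LocalRing L v))) (finGammaTwo L v εH • (1 : Matrix (Fin 1) (Fin 1) (UnitaryGroup.LocalRing L v)))) := by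
    rw [← h2u]; exact hε'P
  -- (1′) the framed second class is matched with `ε_H`: `ε′ = (P′W)·ι_v(ε_H)·(P′W)⁻¹`
  have hWW : W * W = 1 := Units.ext (by rw [Units.val_mul, hW, swap_mul_swap₁₁, Units.val_one])
  have hconj : P' * W * ((endoEmbLocal L v εH).val : GL (Fin 3) (UnitaryGroup.LocalRing L v)) * (P' * W)⁻¹ = (ε'.val : GL (Fin 3) (UnitaryGroup.LocalRing L v)) := by
    rw [hε'val, hT, _root_.mul_inv_rev, inv_eq_of_mul_eq_one_right hWW]
    simp only [mul_assoc]
  have hmatch : IsLocalNormPair L H' v εH ε' := isConj_iff.2 ⟨P' * W, hconj⟩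
  -- (2) the bad block is hermitian, non-degenerate and ANISOTROPIC (★ B-p04); the corner `G₂′` is a unit; so `C′ := Z(ε′)` is COMPACT (★ A-p17)
  obtain ⟨hG₁', hG₁'d⟩ := badBlock_herm_and_isUnit_det L H' v hherm hdet' hP'
  have hanis' : ∀ x : Fin 2 → (UnitaryGroup.LocalRing L v), hermForm (UnitaryGroup.conjLocal L (IsCMField.complexConj L) v) G₁' x x = 0 → x = 0 :=
    anisotropic_of_neg_det_not_norm L v w hw hG₁' hG₁'d (not_exists_neg_det_badBlock_eq_norm L H' v w hw hherm hdet' θ hθ hW hPW hnn)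
  have hG₂'u : IsUnit (G₂' 0 0) := by
    have hd' : G₁'.det * G₂' 0 0 = (UnitaryGroup.conjLocal L (IsCMField.complexConj L) v) P'.val.det * ((UnitaryGroup.adelicForm L 3 H').map (UnitaryGroup.adeleToLocal L v)).det * P'.val.det := by
      rw [← Matrix.det_fin_one G₂', ← UnitaryGroup.det_finSum, ← hP', det_twistGram]
    refine isUnit_of_mul_isUnit_right (?_ : IsUnit (G₁'.det * G₂' 0 0))
    rw [hd']
    exact (((Matrix.isUnits_det_units P').map _).mul hHd).mul (Matrix.isUnits_det_units P')
  haveI hC : CompactSpace ↥(Subgroup.centralizer ({ε'} : Set ((UnitaryGroup.cmDatum L 3 H').Local v))) := compactSpace_centralizer_of_frame_of_anisotropic L v H' ε' w hw hau hε'D hP' hanis' hG₂'u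
  -- (3) the carrier data on `C′ := Z(ε′)`: Borel σ-algebras, local compactness, Haar `ν′` (right-invariant on a compact group), `P″ :=` regular
  letI iC : MeasurableSpace ↥(Subgroup.centralizer ({ε'} : Set ((UnitaryGroup.cmDatum L 3 H').Local v))) := borel _
  haveI bC : BorelSpace ↥(Subgroup.centralizer ({ε'} : Set ((UnitaryGroup.cmDatum L 3 H').Local v))) := ⟨rfl⟩
  letI iCq : ∀ m : ↥(Subgroup.centralizer ({ε'} : Set ((UnitaryGroup.cmDatum L 3 H').Local v))), MeasurableSpace (↥(Subgroup.centralizer ({ε'} : Set ((UnitaryGroup.cmDatum L 3 H').Local v))) ⧸ Subgroup.centralizer ({m} : Set ↥(Subgroup.centralizer ({ε'} : Set ((UnitaryGroup.cmDatum L 3 H').Local v))))) := fun _ => borel _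
  haveI bCq : ∀ m : ↥(Subgroup.centralizer ({ε'} : Set ((UnitaryGroup.cmDatum L 3 H').Local v))), BorelSpace (↥(Subgroup.centralizer ({ε'} : Set ((UnitaryGroup.cmDatum L 3 H').Local v))) ⧸ Subgroup.centralizer ({m} : Set ↥(Subgroup.centralizer ({ε'} : Set ((UnitaryGroup.cmDatum L 3 H').Local v))))) := fun _ => ⟨rfl⟩
  haveI : LocallyCompactSpace ↥(Subgroup.centralizer ({ε'} : Set ((UnitaryGroup.cmDatum L 3 H').Local v))) := (isClosed_coe_centralizer_singleton ε').isClosedEmbedding_subtypeVal.locallyCompactSpace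
  haveI hνr : (Measure.haar : Measure ↥(Subgroup.centralizer ({ε'} : Set ((UnitaryGroup.cmDatum L 3 H').Local v)))).IsMulRightInvariant := isMulRightInvariant_of_compactSpace _
  obtain ⟨P'', hP''⟩ : ∃ P'' : ↥(Subgroup.centralizer ({ε'} : Set ((UnitaryGroup.cmDatum L 3 H').Local v))) → Prop, P'' = fun m : ↥(Subgroup.centralizer ({ε'} : Set ((UnitaryGroup.cmDatum L 3 H').Local v))) => IsRegularElt ((m.1.val : GL (Fin 3) (UnitaryGroup.LocalRing L v))) := ⟨_, rfl⟩
  have hP''reg : ∀ m : ↥(Subgroup.centralizer ({ε'} : Set ((UnitaryGroup.cmDatum L 3 H').Local v))), IsRegularElt ((m.1.val : GL (Fin 3) (UnitaryGroup.LocalRing L v))) → P'' m := fun m h => by rw [hP'']; exact h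
  -- (4) a canonical orbital-measure family on the compact group `C′` (centralisers of regular elements are commutative; the compact core is everything)
  have ht : ∀ m : ↥(Subgroup.centralizer ({ε'} : Set ((UnitaryGroup.cmDatum L 3 H').Local v))), P'' m →
      ∃ t : Measure ↥(Subgroup.centralizer ({m} : Set ↥(Subgroup.centralizer ({ε'} : Set ((UnitaryGroup.cmDatum L 3 H').Local v))))), t.IsHaarMeasure ∧ t.IsInvInvariant ∧ t (compactCore ↥(Subgroup.centralizer ({m} : Set ↥(Subgroup.centralizer ({ε'} : Set ((UnitaryGroup.cmDatum L 3 H').Local v)))))) = 1 := by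
    intro m hm
    rw [hP''] at hm
    haveI : CompactSpace ↥(Subgroup.centralizer ({m} : Set ↥(Subgroup.centralizer ({ε'} : Set ((UnitaryGroup.cmDatum L 3 H').Local v))))) :=
      isCompact_iff_compactSpace.mp (isClosed_coe_centralizer_singleton m).isCompact
    haveI : LocallyCompactSpace ↥(Subgroup.centralizer ({m} : Set ↥(Subgroup.centralizer ({ε'} : Set ((UnitaryGroup.cmDatum L 3 H').Local v))))) :=
      (isClosed_coe_centralizer_singleton m).isClosedEmbedding_subtypeVal.locallyCompactSpace
    have hcomm : ∀ p q : ↥(Subgroup.centralizer ({m} : Set ↥(Subgroup.centralizer ({ε'} : Set ((UnitaryGroup.cmDatum L 3 H').Local v))))), p * q = q * p := by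
      intro p q
      have hp := Subgroup.mem_centralizer_singleton_iff.mp p.2
      have hq := Subgroup.mem_centralizer_singleton_iff.mp q.2
      have hp' : Commute ((p.1.1.val : GL (Fin 3) (UnitaryGroup.LocalRing L v)).val) ((m.1.val : GL (Fin 3) (UnitaryGroup.LocalRing L v)).val) := by
        have := congrArg (fun z : ↥(Subgroup.centralizer ({ε'} : Set ((UnitaryGroup.cmDatum L 3 H').Local v))) => ((z.1.val : GL (Fin 3) (UnitaryGroup.LocalRing L v)).val : Matrix (Fin 3) (Fin 3) (UnitaryGroup.LocalRing L v))) hp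
        exact this
      have hq' : Commute ((q.1.1.val : GL (Fin 3) (UnitaryGroup.LocalRing L v)).val) ((m.1.val : GL (Fin 3) (UnitaryGroup.LocalRing L v)).val) := by
        have := congrArg (fun z : ↥(Subgroup.centralizer ({ε'} : Set ((UnitaryGroup.cmDatum L 3 H').Local v))) => ((z.1.val : GL (Fin 3) (UnitaryGroup.LocalRing L v)).val : Matrix (Fin 3) (Fin 3) (UnitaryGroup.LocalRing L v))) hq
        exact this
      have hc := UnitaryGroup.commute_of_commute_of_isRegularElt_local L v m.1 hm _ _ hp' hq'
      apply Subtype.ext; apply Subtype.ext; apply Subtype.ext; apply Units.ext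
      exact hc.eq
    have hcc : compactCore ↥(Subgroup.centralizer ({m} : Set ↥(Subgroup.centralizer ({ε'} : Set ((UnitaryGroup.cmDatum L 3 H').Local v))))) = Set.univ := compactCore_eq_univ _
    obtain ⟨t, ht1, ht2, ht3⟩ := exists_isHaarMeasure_compactCore_eq_one hcomm (by rw [hcc]; exact isCompact_univ) (by rw [hcc]; exact isOpen_univ)
    exact ⟨t, ht1, ht2, ht3⟩
  obtain ⟨m', hm'⟩ := OrbitalMeasureFamily.exists_isCanonical P'' (Measure.haar : Measure ↥(Subgroup.centralizer ({ε'} : Set ((UnitaryGroup.cmDatum L 3 H').Local v)))) ht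
  -- (5) the framed second class is matched with `ε_H`, central in `C′`; `ν′(C′) ≠ 0`
  have hcentral : ∀ k : ↥(Subgroup.centralizer ({ε'} : Set ((UnitaryGroup.cmDatum L 3 H').Local v))),
      k * ⟨ε', Subgroup.mem_centralizer_singleton_iff.mpr rfl⟩ * k⁻¹ = ⟨ε', Subgroup.mem_centralizer_singleton_iff.mpr rfl⟩ := by
    intro k
    rw [mul_inv_eq_iff_eq_mul]
    exact Subtype.ext (Subgroup.mem_centralizer_singleton_iff.mp k.2)
  have hν'ne : ((((Measure.haar : Measure ↥(Subgroup.centralizer ({ε'} : Set ((UnitaryGroup.cmDatum L 3 H').Local v)))).real Set.univ : ℝ)) : ℂ) ≠ 0 := by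
    rw [Ne, Complex.ofReal_eq_zero, measureReal_def, ENNReal.toReal_eq_zero_iff, not_or]
    exact ⟨isOpen_univ.measure_ne_zero _ Set.univ_nonempty, measure_ne_top _ _⟩
  -- (6) assemble: (D2ε′)+(sat′)+value ★ rung 2, (Δ-θ′) named ★ rung 4, (CNT) ★ B-p04 — BY NAME
  exact ⟨↥(Subgroup.centralizer ({ε'} : Set ((UnitaryGroup.cmDatum L 3 H').Local v))), inferInstance, inferInstance, inferInstance, hC, inferInstance, inferInstance, inferInstance, iC, bC, iCq, bCq,
    (Measure.haar : Measure ↥(Subgroup.centralizer ({ε'} : Set ((UnitaryGroup.cmDatum L 3 H').Local v)))), inferInstance, hνr, P'', m', hm', ⟨ε', Subgroup.mem_centralizer_singleton_iff.mpr rfl⟩, ε',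
    hε'P, hmatch, hcentral, hν'ne,
    exists_isLocallyConstant_descent_secondClass_and_apply_centre L H' v hherm hdet' w hw (νG v) hmG εH a ha hu hP' hanis' ε' hε'P (Measure.haar : Measure ↥(Subgroup.centralizer ({ε'} : Set ((UnitaryGroup.cmDatum L 3 H').Local v)))) P'' hP''reg hm',
    exists_nhds_finExplicitCollection_Δ_eq_secondClass_of_frame L H' v w hw μ εH a ha hu P' ε' hε'P hmatch,
    exists_nhds_matched_badFrame_count L H' v w hw hherm hdet' εH θ hθ hW hPW hP' hnn⟩

end Literature.NumberTheory.Rogawski1990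

end
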